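import Summits.Parity.BatemanHorn.Theorems.SoloInformedErdosNairFinalA
import Summits.Parity.BatemanHorn.Theorems.SoloInformedErdosNairClassII
import Summits.Parity.BatemanHorn.Theorems.SoloInformedErdosNairClassIII
import Summits.Parity.BatemanHorn.Theorems.SoloInformedErdosUpperBoundNT

/-!
# Erdős's theorem `∑_{n ≤ x} τ(|g(n)|) ≪_g x log x` — unconditional

Solo informed line (Parity / Bateman–Horn), session 139.  The assembly of the Shiu–Nair class
estimates (`SoloInformedErdosNairClassI–IV`, `…FinalA`) at `w = N^{1/8}`, `z = N^{1/4}`: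

* `classII_final`, `classIII_final` — the two classes bounded through the divisor bound
  `τ(m_n) ≤ C_F N^{1/96}` against the savings `w^{−1/3}`, `w^{−1/6}`;
* `exists_sum_card_divisors_le` — **Erdős (1952)**: for `g ∈ ℤ[X]` with `IsBatemanHornSystem ![g]`
  (irreducible, positive leading coefficient, no fixed prime divisor) and `deg g ≥ 1`,
  `∑_{n ≤ N} τ(|g(n)|) ≤ K_g · N log N` for `N ≥ 256`;
* `exists_polyDivisorSum_le_mul_log`, `exists_polyLocatedRootCount_le_mul_log` (+ `_neg`) — the
  statements of `SoloInformedErdosUpperBoundNT` with the named fact `NairTenenbaum1998_theorem1_printed`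
  DISCHARGED: `S_g(x) ≤ K x log x` and, for `deg g ≥ 2`, `Mid_g(x) ≤ K' x log x` for all `x ≥ 2`.

Everything is PROVED: the inputs are the tree's sieve of Eratosthenes–Legendre for polynomial sets
(`polySegment_sieve_bound'`), the weight estimates (`SoloInformedErdosNairWeights`), Mertens along
`g` (`BatemanHornMertens`), and the root-count bounds (`PolynomialCongruencesRootCount`).
No definitions, no named facts.

References: P. Erdős, J. London Math. Soc. 27 (1952) 7–15 [Erdos1952]; P. Shiu, J. reine angew.
Math. 313 (1980) 161–170 [Shiu1980]; M. Nair, Acta Arith. 62 (1992) 257–269 [Nair1992];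
M. Nair, G. Tenenbaum, Acta Math. 180 (1998) 119–144 [NairTenenbaum1998].
-/

open Finset Real Polynomial

namespace Summit.Parity.BatemanHorn.Theorems

open Literature.NumberTheory.Sieve

namespace ErdosDivisor

/-- **Class II at `w = N^{1/8}`, `z = N^{1/4}`**: `∑_{n ≤ N, m_n > z, P_n ≤ w, c_n ≤ w} τ(m_n) ≤ K_II N log N`
for `N ≥ 256`. [cite: Shiu1980, §4 (∑_II)]; [this work] -/
theorem classII_final {g : ℤ[X]} (hg : IsBatemanHornSystem ![g]) (hdeg : 0 < g.natDegree) :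
    ∃ K : ℝ, ∀ N : ℕ, 256 ≤ N →
      ∑ n ∈ (Icc 1 N).filter (fun n : ℕ =>
          (N : ℝ) ^ (1 / 4 : ℝ) < (((g.eval (n : ℤ)).natAbs : ℕ) : ℝ) ∧
          (Shiu.cutPrime ((N : ℝ) ^ (1 / 4 : ℝ)) (g.eval (n : ℤ)).natAbs : ℝ) ≤ (N : ℝ) ^ (1 / 8 : ℝ) ∧
          (Shiu.cPart ((N : ℝ) ^ (1 / 4 : ℝ)) (g.eval (n : ℤ)).natAbs : ℝ) ≤ (N : ℝ) ^ (1 / 8 : ℝ)),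
          (#((g.eval (n : ℤ)).natAbs.divisors) : ℝ) ≤ K * ((N : ℝ) * Real.log N) := by
  classical
  obtain ⟨D, hD, hW, hW1⟩ := exists_rootCount_data hg hdeg
  obtain ⟨CF, hCF0, hF⟩ := exists_card_divisors_eval_le hdeg
  refine ⟨CF * D * 8, fun N hN => ?_⟩
  have hN1' : 1 ≤ N := by omega
  have hN1 : (1 : ℝ) ≤ N := by exact_mod_cast hN1'
  have hN0 : (0 : ℝ) < N := by linarith
  obtain ⟨hw2, hwz, -, -, -, hℓ1, -⟩ := params hN
  obtain ⟨-, -, -, -, h5, h6, -⟩ := rpow_facts hN1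
  set ℓ := Real.log N with hℓ
  set w := (N : ℝ) ^ (1 / 8 : ℝ) with hw
  set z := (N : ℝ) ^ (1 / 4 : ℝ) with hz
  have hF0 : 0 ≤ CF * (N : ℝ) ^ (1 / 96 : ℝ) := by positivity
  have h := polyClassII_bound g hW N hw2 hwz hF0 (hF N hN1')
  refine h.trans ?_
  clear h
  have hD0 : (0 : ℝ) ≤ D := Nat.cast_nonneg _
  have h1 : (N : ℝ) ^ (1 / 96 : ℝ) * (7 * N * w ^ (-(1 / 3 : ℝ)) + w) ≤ 8 * N := by
    have e : (N : ℝ) ^ (1 / 96 : ℝ) * (7 * N * w ^ (-(1 / 3 : ℝ)) + w) =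
        7 * ((N : ℝ) ^ (1 / 96 : ℝ) * N * w ^ (-(1 / 3 : ℝ))) + (N : ℝ) ^ (1 / 96 : ℝ) * w := by
      ring
    rw [e]; linarith
  have h2 : (N : ℝ) ≤ N * ℓ := by nlinarith [mul_nonneg hN0.le (sub_nonneg.2 hℓ1)]
  calc CF * (N : ℝ) ^ (1 / 96 : ℝ) * D * (7 * N * w ^ (-(1 / 3 : ℝ)) + w)
      = CF * D * ((N : ℝ) ^ (1 / 96 : ℝ) * (7 * N * w ^ (-(1 / 3 : ℝ)) + w)) := by ring
    _ ≤ CF * D * (8 * N) := mul_le_mul_of_nonneg_left h1 (by positivity)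
    _ ≤ CF * D * (8 * (N * ℓ)) := by gcongr
    _ = CF * D * 8 * ((N : ℝ) * ℓ) := by ring

/-- **Class III at `w = N^{1/8}`, `z = N^{1/4}`** (any fixed `L ≥ 2`):
`∑_{n ≤ N, m_n > z, P_n ≤ L, c_n > w} τ(m_n) ≤ K_III(L) N log N` for `N ≥ 256`.
[cite: Shiu1980, §5 (∑_III)]; [this work] -/
theorem classIII_final {g : ℤ[X]} (hg : IsBatemanHornSystem ![g]) (hdeg : 0 < g.natDegree)
    {L : ℝ} (hL : 2 ≤ L) :
    ∃ K : ℝ, ∀ N : ℕ, 256 ≤ N →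
      ∑ n ∈ (Icc 1 N).filter (fun n : ℕ =>
          (N : ℝ) ^ (1 / 4 : ℝ) < (((g.eval (n : ℤ)).natAbs : ℕ) : ℝ) ∧
          (Shiu.cutPrime ((N : ℝ) ^ (1 / 4 : ℝ)) (g.eval (n : ℤ)).natAbs : ℝ) ≤ L ∧
          (N : ℝ) ^ (1 / 8 : ℝ) < (Shiu.cPart ((N : ℝ) ^ (1 / 4 : ℝ)) (g.eval (n : ℤ)).natAbs : ℝ)),
          (#((g.eval (n : ℤ)).natAbs.divisors) : ℝ) ≤ K * ((N : ℝ) * Real.log N) := by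
  classical
  have hg' := hg.hasNoFixedPrimeDivisor
  obtain ⟨D, hD, hW, hW1⟩ := exists_rootCount_data hg hdeg
  obtain ⟨K, hK, hIII⟩ := polyClassIII_bound hg' hD hW hW1
  obtain ⟨CF, hCF0, hF⟩ := exists_card_divisors_eval_le hdeg
  set E : ℝ := Real.exp (2 * (D : ℝ) * (1 + (D : ℝ)) * (1 / 6) * L ^ (1 / 6 : ℝ) *
    (Real.log L + Real.log 4)) with hE
  set Q : ℝ := ((∏ p ∈ Nat.primesBelow ⌈L⌉₊, (1 - (polyRootCountMod ![g] p : ℝ) / p)) ^ 2)⁻¹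
    with hQ
  have hE0 : 0 < E := Real.exp_pos _
  have hQ0 : 0 ≤ Q := by positivity
  refine ⟨CF * K * 2 * E * Q, fun N hN => ?_⟩
  have hN1' : 1 ≤ N := by omega
  have hN1 : (1 : ℝ) ≤ N := by exact_mod_cast hN1'
  have hN0 : (0 : ℝ) < N := by linarith
  obtain ⟨hw2, hwz, -, -, hzN, hℓ1, -⟩ := params hN
  obtain ⟨-, -, -, -, -, -, h7⟩ := rpow_facts hN1
  set ℓ := Real.log N with hℓ
  set w := (N : ℝ) ^ (1 / 8 : ℝ) with hw
  set z := (N : ℝ) ^ (1 / 4 : ℝ) with hz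
  have hw0 : 0 < w := by linarith
  have hF0 : 0 ≤ CF * (N : ℝ) ^ (1 / 96 : ℝ) := by positivity
  have h := hIII N z w L (CF * (N : ℝ) ^ (1 / 96 : ℝ)) hw2 hwz hL hF0 (hF N hN1')
  rw [← hE, ← hQ] at h
  refine h.trans ?_
  clear h hIII
  have h1 : (N : ℝ) ^ (1 / 96 : ℝ) * (((N : ℝ) + z) * w ^ (-(1 / 6 : ℝ))) ≤ 2 * N :=
    calc (N : ℝ) ^ (1 / 96 : ℝ) * (((N : ℝ) + z) * w ^ (-(1 / 6 : ℝ)))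
        = ((N : ℝ) + z) * ((N : ℝ) ^ (1 / 96 : ℝ) * w ^ (-(1 / 6 : ℝ))) := by ring
      _ ≤ (2 * N) * 1 := mul_le_mul (by linarith) h7 (by positivity) (by positivity)
      _ = 2 * N := by ring
  have h2 : (N : ℝ) ≤ N * ℓ := by nlinarith [mul_nonneg hN0.le (sub_nonneg.2 hℓ1)]
  calc CF * (N : ℝ) ^ (1 / 96 : ℝ) * K * ((N : ℝ) + z) * w ^ (-(1 / 6 : ℝ)) * E * Q
      = CF * K * E * Q * ((N : ℝ) ^ (1 / 96 : ℝ) * (((N : ℝ) + z) * w ^ (-(1 / 6 : ℝ)))) := by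
        ring
    _ ≤ CF * K * E * Q * (2 * N) := mul_le_mul_of_nonneg_left h1 (by positivity)
    _ ≤ CF * K * E * Q * (2 * (N * ℓ)) := by gcongr
    _ = CF * K * 2 * E * Q * ((N : ℝ) * ℓ) := by ring

/-- **Erdős's theorem** (1952), by the Shiu–Nair method: for `g ∈ ℤ[X]` with `IsBatemanHornSystem ![g]`
(irreducible, positive leading coefficient, no fixed prime divisor) and `deg g ≥ 1` there is `K = K_g`
with `∑_{n ≤ N} τ(|g(n)|) ≤ K · N log N` for all `N ≥ 256`.
[cite: Shiu1980, Theorem 1 (method)]; Erdős, J. London Math. Soc. 27 (1952) 7–15; [this work] -/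
theorem exists_sum_card_divisors_le {g : ℤ[X]} (hg : IsBatemanHornSystem ![g])
    (hdeg : 0 < g.natDegree) :
    ∃ K : ℝ, ∀ N : ℕ, 256 ≤ N →
      ∑ n ∈ Icc 1 N, (#((g.eval (n : ℤ)).natAbs.divisors) : ℝ) ≤ K * ((N : ℝ) * Real.log N) := by
  classical
  obtain ⟨K₁, hK₁⟩ := classI_final hg hdeg
  obtain ⟨K₂, hK₂⟩ := classII_final hg hdeg
  obtain ⟨L, hL4, K₄, hK₄⟩ := classIV_final hg hdeg
  obtain ⟨K₃, hK₃⟩ := classIII_final hg hdeg (by linarith : (2 : ℝ) ≤ L)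
  refine ⟨4 * g.natDegree + (K₁ + K₂ + K₃ + K₄), fun N hN => ?_⟩
  have hN1 : (1 : ℝ) ≤ N := by exact_mod_cast (by omega : 1 ≤ N)
  have hN0 : (0 : ℝ) < N := by linarith
  obtain ⟨hw2, hwz, -, -, hzN, hℓ1, -⟩ := params hN
  obtain ⟨hzz, -, -, -, -, -, -⟩ := rpow_facts hN1
  have h1 := hK₁ N hN
  have h2 := hK₂ N hN
  have h3 := hK₃ N hN
  have h4 := hK₄ N hN
  set ℓ := Real.log N with hℓ
  set w := (N : ℝ) ^ (1 / 8 : ℝ) with hw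
  set z := (N : ℝ) ^ (1 / 4 : ℝ) with hz
  have hw0 : 0 < w := by linarith
  have hz1 : 1 ≤ z := by nlinarith
  have hz0 : 0 ≤ z := by linarith
  -- small values `m_n ≤ z`
  have hsmall := sum_card_divisors_small_le g hdeg (Icc 1 N) hz0
  have hsmall' : 2 * (g.natDegree : ℝ) * (z + 1) * z ≤ 4 * g.natDegree * ((N : ℝ) * ℓ) := by
    have hzz2 : (z + 1) * z ≤ 2 * (N : ℝ) ^ (1 / 2 : ℝ) := by rw [← hzz]; nlinarith
    have hhalf : (N : ℝ) ^ (1 / 2 : ℝ) ≤ N := by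
      conv_rhs => rw [← Real.rpow_one (N : ℝ)]
      exact Real.rpow_le_rpow_of_exponent_le hN1 (by norm_num)
    have hNℓ : (N : ℝ) ≤ N * ℓ := by nlinarith [mul_nonneg hN0.le (sub_nonneg.2 hℓ1)]
    have hd : (0 : ℝ) ≤ g.natDegree := Nat.cast_nonneg _
    calc 2 * (g.natDegree : ℝ) * (z + 1) * z = 2 * g.natDegree * ((z + 1) * z) := by ring
      _ ≤ 2 * g.natDegree * (2 * ((N : ℝ) * ℓ)) :=
          mul_le_mul_of_nonneg_left (by linarith) (by positivity)
      _ = 4 * g.natDegree * ((N : ℝ) * ℓ) := by ring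
  -- the split `[1, N] = {m_n ≤ z} ∪ {m_n > z}` and the four classes
  have hsplit : ∑ n ∈ Icc 1 N, (#((g.eval (n : ℤ)).natAbs.divisors) : ℝ) =
      ∑ n ∈ (Icc 1 N).filter (fun n : ℕ => (((g.eval (n : ℤ)).natAbs : ℕ) : ℝ) ≤ z),
          (#((g.eval (n : ℤ)).natAbs.divisors) : ℝ) +
        ∑ n ∈ (Icc 1 N).filter (fun n : ℕ => z < (((g.eval (n : ℤ)).natAbs : ℕ) : ℝ)),
          (#((g.eval (n : ℤ)).natAbs.divisors) : ℝ) := by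
    rw [← sum_filter_add_sum_filter_not (Icc 1 N)
      (fun n : ℕ => (((g.eval (n : ℤ)).natAbs : ℕ) : ℝ) ≤ z)]
    exact congrArg₂ (· + ·) rfl (sum_congr (filter_congr fun n _ => not_le) fun _ _ => rfl)
  have hτ0 : ∀ n ∈ (Icc 1 N).filter (fun n : ℕ => z < (((g.eval (n : ℤ)).natAbs : ℕ) : ℝ)),
      (0 : ℝ) ≤ (#((g.eval (n : ℤ)).natAbs.divisors) : ℝ) := fun _ _ => Nat.cast_nonneg _
  have hcover : ∀ n ∈ (Icc 1 N).filter (fun n : ℕ => z < (((g.eval (n : ℤ)).natAbs : ℕ) : ℝ)),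
      w < (Shiu.cutPrime z (g.eval (n : ℤ)).natAbs : ℝ) ∨
      ((Shiu.cutPrime z (g.eval (n : ℤ)).natAbs : ℝ) ≤ w ∧
        (Shiu.cPart z (g.eval (n : ℤ)).natAbs : ℝ) ≤ w) ∨
      ((Shiu.cutPrime z (g.eval (n : ℤ)).natAbs : ℝ) ≤ L ∧
        w < (Shiu.cPart z (g.eval (n : ℤ)).natAbs : ℝ)) ∨
      (L < (Shiu.cutPrime z (g.eval (n : ℤ)).natAbs : ℝ) ∧
        (Shiu.cutPrime z (g.eval (n : ℤ)).natAbs : ℝ) ≤ w ∧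
        w < (Shiu.cPart z (g.eval (n : ℤ)).natAbs : ℝ)) := by
    intro n _
    by_cases hP : w < (Shiu.cutPrime z (g.eval (n : ℤ)).natAbs : ℝ)
    · exact Or.inl hP
    rw [not_lt] at hP
    by_cases hc : (Shiu.cPart z (g.eval (n : ℤ)).natAbs : ℝ) ≤ w
    · exact Or.inr (Or.inl ⟨hP, hc⟩)
    rw [not_le] at hc
    by_cases hPL : (Shiu.cutPrime z (g.eval (n : ℤ)).natAbs : ℝ) ≤ L
    · exact Or.inr (Or.inr (Or.inl ⟨hPL, hc⟩))
    rw [not_le] at hPL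
    exact Or.inr (Or.inr (Or.inr ⟨hPL, hP, hc⟩))
  have h4way := Shiu.sum_le_sum_four_filter hτ0 _ _ _ _ hcover
  simp only [filter_filter] at h4way
  have hrest : ∑ n ∈ (Icc 1 N).filter (fun n : ℕ => z < (((g.eval (n : ℤ)).natAbs : ℕ) : ℝ)),
      (#((g.eval (n : ℤ)).natAbs.divisors) : ℝ) ≤ (K₁ + K₂ + K₃ + K₄) * ((N : ℝ) * ℓ) := by
    refine h4way.trans ?_
    have := add_le_add (add_le_add (add_le_add h1 h2) h3) h4
    linarith
  rw [hsplit]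
  have := add_le_add (hsmall.trans hsmall') hrest
  linarith

end ErdosDivisor

/-! ### Erdős's upper bound and the located root count, unconditionally -/

/-- **Erdős's upper bound** (the statement of `exists_polyDivisorSum_le_mul_log_of_NT` with the
Nair–Tenenbaum named fact discharged): for every `g ∈ ℤ[X]` with `IsBatemanHornSystem ![g]` and
`deg g ≥ 1` there is `K` with `S_g(x) = ∑_{n ≤ x} τ(|g(n)|) ≤ K · x log x` for all integers `x ≥ 2`.
Erdős, J. London Math. Soc. 27 (1952) 7–15; [cite: Shiu1980, Theorem 1 (method)]; [this work] -/
theorem exists_polyDivisorSum_le_mul_log {g : ℤ[X]} (hg : IsBatemanHornSystem ![g])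
    (hdeg : 0 < g.natDegree) :
    ∃ K : ℝ, ∀ x : ℕ, 2 ≤ x → (polyDivisorSum g x : ℝ) ≤ K * ((x : ℝ) * Real.log x) := by
  obtain ⟨K, hK⟩ := ErdosDivisor.exists_sum_card_divisors_le hg hdeg
  obtain ⟨S₀, hS₀⟩ : ∃ S₀ : ℝ, S₀ = (polyDivisorSum g 256 : ℝ) := ⟨_, rfl⟩
  have hS₀0 : 0 ≤ S₀ := hS₀ ▸ Nat.cast_nonneg _
  have hl2 : (1 : ℝ) / 2 < Real.log 2 := by
    have := Real.log_two_gt_d9; norm_num at this ⊢; linarith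
  refine ⟨max K S₀, fun x hx => ?_⟩
  have hxr : (2 : ℝ) ≤ x := by exact_mod_cast hx
  have hlogx : Real.log 2 ≤ Real.log x := Real.log_le_log (by norm_num) hxr
  have hxlogx : (1 : ℝ) ≤ (x : ℝ) * Real.log x := by nlinarith
  have hxlogx0 : (0 : ℝ) ≤ (x : ℝ) * Real.log x := zero_le_one.trans hxlogx
  by_cases h256 : 256 ≤ x
  · rw [polyDivisorSum_cast]
    exact (hK x h256).trans (mul_le_mul_of_nonneg_right (le_max_left _ _) hxlogx0)
  · have hmono : (polyDivisorSum g x : ℝ) ≤ S₀ := by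
      rw [hS₀]; exact_mod_cast polyDivisorSum_mono g (by omega)
    calc (polyDivisorSum g x : ℝ) ≤ S₀ := hmono
      _ ≤ S₀ * ((x : ℝ) * Real.log x) := le_mul_of_one_le_right hS₀0 hxlogx
      _ ≤ max K S₀ * ((x : ℝ) * Real.log x) :=
          mul_le_mul_of_nonneg_right (le_max_right _ _) hxlogx0

/-- **The located root count is `O(x log x)`**, unconditionally: for `g` with `IsBatemanHornSystem ![g]`
and `deg g ≥ 2` there is `K` with `Mid_g(x) ≤ K · x log x` for all `x ≥ 2` — the Chebyshev-order upper
half of the located-root-count conjecture `Mid_g(x) ∼ ((d−2)/2) A_g x log x`, through the landed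
equivalence `polyDivisorSum_upper_iff_located_upper`. [this work] -/
theorem exists_polyLocatedRootCount_le_mul_log {g : ℤ[X]} (hg : IsBatemanHornSystem ![g])
    (hdeg : 2 ≤ g.natDegree) :
    ∃ K : ℝ, ∀ x : ℕ, 2 ≤ x → (polyLocatedRootCount g x : ℝ) ≤ K * ((x : ℝ) * Real.log x) := by
  have hirr0 : Irreducible g := by simpa using hg.irreducible 0
  exact (polyDivisorSum_upper_iff_located_upper hirr0 hdeg).mp
    (exists_polyDivisorSum_le_mul_log hg (by omega))

/-- Erdős's upper bound for `g` with `IsBatemanHornSystem ![-g]` (negative leading coefficient).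
[this work] -/
theorem exists_polyDivisorSum_le_mul_log_neg {g : ℤ[X]} (hg : IsBatemanHornSystem ![-g])
    (hdeg : 0 < g.natDegree) :
    ∃ K : ℝ, ∀ x : ℕ, 2 ≤ x → (polyDivisorSum g x : ℝ) ≤ K * ((x : ℝ) * Real.log x) := by
  obtain ⟨K, hK⟩ := exists_polyDivisorSum_le_mul_log hg (by rwa [natDegree_neg])
  exact ⟨K, fun x hx => by rw [← polyDivisorSum_neg]; exact hK x hx⟩

/-- The located root count bound for `g` with `IsBatemanHornSystem ![-g]`. [this work] -/
theorem exists_polyLocatedRootCount_le_mul_log_neg {g : ℤ[X]} (hg : IsBatemanHornSystem ![-g])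
    (hdeg : 2 ≤ g.natDegree) :
    ∃ K : ℝ, ∀ x : ℕ, 2 ≤ x → (polyLocatedRootCount g x : ℝ) ≤ K * ((x : ℝ) * Real.log x) := by
  obtain ⟨K, hK⟩ := exists_polyLocatedRootCount_le_mul_log hg (by rwa [natDegree_neg])
  exact ⟨K, fun x hx => by rw [← polyLocatedRootCount_neg]; exact hK x hx⟩

/-- The hypothesis of the conditional file is now superfluous: the conclusion of
`exists_polyDivisorSum_le_mul_log_of_NT` holds without `NairTenenbaum1998_theorem1_printed`.
[this work] -/
theorem exists_polyDivisorSum_le_mul_log_of_NT_iff {g : ℤ[X]} (hg : IsBatemanHornSystem ![g])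
    (hdeg : 0 < g.natDegree) :
    (NairTenenbaum1998_theorem1_printed →
      ∃ K : ℝ, ∀ x : ℕ, 2 ≤ x → (polyDivisorSum g x : ℝ) ≤ K * ((x : ℝ) * Real.log x)) ↔
    (∃ K : ℝ, ∀ x : ℕ, 2 ≤ x → (polyDivisorSum g x : ℝ) ≤ K * ((x : ℝ) * Real.log x)) :=
  ⟨fun _ => exists_polyDivisorSum_le_mul_log hg hdeg, fun h _ => h⟩

end Summit.Parity.BatemanHorn.Theorems
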